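import Summits.QuantumFields.YangMills.Theorems.LuscherReductionTwistedTraceScalingInnerVacuumSplit
import Summits.QuantumFields.YangMills.Theorems.LuscherReductionTwistedTraceScalingStepActionExact
import Summits.QuantumFields.YangMills.Theorems.LuscherReductionRunningReductionConstLift
import HarnessLib

/-!
# C4 INNER, brick G2: the SLOW MANIFOLD `constLift u` — translation invariance, the gradient of the action is a CONSTANT mode, and the action of a STIFF step
# from it has NO LINEAR TERM: `S(W·constLift u) = L³S₁(u) + (quadratic in D_u w) + E`
# (lane A of S-BASE, crux `TwistedTraceScaling` stmt-QuantumFields-20203; sub-target C4, design note `pub/ym-fleet/ym-luscher-20007-p1/COARSE-DESIGN.md` §21.9 (1)–(2))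

The product chart of the inner region takes a step `W` with `linkVec W = w ∈ stiffSpace L` (`…InnerVacuumSplit`) from the slow manifold `{constLift u}` (`…ConstLift`,
`transferKernel_constLift`: the lattice kernel there IS the one-site kernel at `L³β`).  Lane A's exact step expansion (`…StepActionExact`, ★★
`abs_wilsonAction_step_sub_quadratic_le`) has a LINEAR term `2⟪D_U w, F(U)⟫`; on the slow manifold it VANISHES for stiff steps:
* §1 `shiftCfg_constLift`, `plaqCurv_shiftCfg`, `plaqCurv_constLift_shift` — the slow manifold and its curvature are translation invariant;
* §2 ★ `adjoint_covCurl_plaqCurv_constLift_mem_constModes` — `D_u† F(constLift u)` (the gradient of `S` at `constLift u`) is a CONSTANT MODE, hence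
  ★ `inner_covCurl_plaqCurv_constLift_eq_zero : ⟪D_u w, F(constLift u)⟫ = 0` for `w ∈ stiffSpace L`;
* §3 ★★ `wilsonAction_stiffStep_le/ge` — for `W` with links in the upper hemisphere, `|vecPart(W_e)_c| ≤ τ ≤ 1/30`, `linkVec W ∈ stiffSpace L`, `S(constLift u) ≤ σ < 2`:
  `L³S₁(u) + (1 − σ/2)‖D_u w‖² − E ≤ S(W·constLift u) ≤ L³S₁(u) + ‖D_u w‖² + E`, `E = stepActionErr τ σ` (`= N_P(1728τ²√σ + 29376τ³ + 700569τ⁴)`; at `τ ≍ β^{−1/2}`,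
  `σ ≍ β^{−1}`: `βE = O(β^{−1/2})`, AFFORDABLE at the precision `o(λ_b)` of C4).
HONEST FRAMING: fixed-lattice algebra for a stub of a child of the CONDITIONAL reduction route (femto rung R2b1); not infinite volume, not a gap, not Clay.

## References
* M. Lüscher, Nucl. Phys. B219 (1983) 233, §3. [Luscher1983]
-/

set_option autoImplicit false

noncomputable section

open Finset Real Module
open scoped BigOperators InnerProductSpace RealInnerProductSpace
open Literature.MathematicalPhysics.QuantumFieldTheory
open Literature.MathematicalPhysics.QuantumLattice

namespace Summit.QuantumFields.YangMills.Theorems.FemtoTransferGap.TwoLattice.Toron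

open Summit.QuantumFields.YangMills.Theorems.FemtoTransferGap
open Summit.QuantumFields.YangMills.Theorems.FemtoTransferGap.TwoLattice
open Summit.QuantumFields.YangMills.Theorems.FemtoTransferGap.TwoLattice.Stiff
open Summit.QuantumFields.YangMills.Theorems.FemtoTransferGap.TwoLattice.Cov

variable {L : ℕ} [NeZero L]

/-! ## §1 Translation invariance of the slow manifold -/

omit [NeZero L] in
/-- `constLift u` is translation invariant. [folklore] -/
theorem shiftCfg_constLift (y : Site 3 L) (u : GaugeConfig 3 1 SU2) : shiftCfg L y (constLift L u) = constLift L u := by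
  funext e; rfl

omit [NeZero L] in
/-- The curvature translates: `F(τ_y U) = τ_y F(U)`. [folklore] -/
theorem plaqCurv_shiftCfg (y : Site 3 L) (U : GaugeConfig 3 L SU2) : plaqCurv (shiftCfg L y U) = shiftPlaq L y (plaqCurv U) := by
  ext ⟨p, a⟩
  rw [plaqCurv_apply, shiftPlaq_apply, plaqCurv_apply, (ptrans_shiftCfg L y U p).2.2]

omit [NeZero L] in
/-- The curvature of the slow manifold is translation invariant. [folklore] -/
theorem shiftPlaq_plaqCurv_constLift (y : Site 3 L) (u : GaugeConfig 3 1 SU2) :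
    shiftPlaq L y (plaqCurv (constLift L u)) = plaqCurv (constLift L u) := by
  rw [← plaqCurv_shiftCfg, shiftCfg_constLift]

omit [NeZero L] in
/-- The covariant curl at the slow manifold commutes with translations. [cite: Luscher1983, §3] -/
theorem covCurl_constLift_shiftLink (y : Site 3 L) (u : GaugeConfig 3 1 SU2) (w : LinkSpace L) :
    covCurl (constLift L u) (shiftLink L y w) = shiftPlaq L y (covCurl (constLift L u) w) := by
  rw [← covCurl_shiftCfg L y (constLift L u) w, shiftCfg_constLift]

/-! ## §2 The gradient of the action at the slow manifold is a constant mode -/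

/-- ★ `D_u† F(constLift u) ∈ constModes L`. [cite: Luscher1983, §3] -/
theorem adjoint_covCurl_plaqCurv_constLift_mem_constModes (u : GaugeConfig 3 1 SU2) :
    (covCurl (constLift L u)).adjoint (plaqCurv (constLift L u)) ∈ constModes L := by
  intro y
  refine ext_inner_left ℝ fun v => ?_
  rw [inner_shiftLink_right, LinearMap.adjoint_inner_right, LinearMap.adjoint_inner_right, covCurl_constLift_shiftLink,
    ← shiftPlaq_plaqCurv_constLift (-y) u]
  rw [inner_shiftPlaq, shiftPlaq_plaqCurv_constLift]

/-- ★ **No linear term for stiff steps from the slow manifold**: `⟪D_u w, F(constLift u)⟫ = 0` for `w ∈ stiffSpace L`. [cite: Luscher1983, §3] -/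
theorem inner_covCurl_plaqCurv_constLift_eq_zero (u : GaugeConfig 3 1 SU2) {w : LinkSpace L} (hw : w ∈ stiffSpace L) :
    ⟪covCurl (constLift L u) w, plaqCurv (constLift L u)⟫_ℝ = 0 := by
  rw [← LinearMap.adjoint_inner_right, real_inner_comm]
  exact inner_eq_zero_of_mem_constModes_of_mem_stiff (adjoint_covCurl_plaqCurv_constLift_mem_constModes u) hw

/-! ## §3 ★★ The action of a stiff step from the slow manifold -/

/-- ★★ **UPPER**: `S(W·constLift u) ≤ S(constLift u) + ‖D_u w‖² + E` for a stiff step (`linkVec W ∈ stiffSpace`). [cite: Luscher1983, §3] -/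
theorem wilsonAction_stiffStep_le (u : GaugeConfig 3 1 SU2) (W : GaugeConfig 3 L SU2) {τ σ : ℝ} (hτ : τ ≤ 1 / 30) (hσ : σ < 2)
    (hS : wilsonAction su2Rep (constLift L u) ≤ σ) (hs : ∀ e : Edge 3 L, 0 ≤ scalarPart (W e)) (hw : ∀ (e : Edge 3 L) (c : Fin 3), |vecPart (W e) c| ≤ τ)
    (hstiff : linkVec L W ∈ stiffSpace L) :
    wilsonAction su2Rep (W * constLift L u) ≤ wilsonAction su2Rep (constLift L u) + ‖covCurl (constLift L u) (linkVec L W)‖ ^ 2 + stepActionErr (L := L) τ σ := by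
  have h := wilsonAction_step_le_valley W (constLift L u) hτ hσ hS hs hw
  rw [inner_covCurl_plaqCurv_constLift_eq_zero u hstiff, mul_zero, add_zero] at h
  exact h

/-- ★★ **LOWER**: `S(constLift u) + (1 − σ/2)‖D_u w‖² − E ≤ S(W·constLift u)` for a stiff step. [cite: Luscher1983, §3] -/
theorem wilsonAction_stiffStep_ge (u : GaugeConfig 3 1 SU2) (W : GaugeConfig 3 L SU2) {τ σ : ℝ} (hτ : τ ≤ 1 / 30) (hσ : σ < 2)
    (hS : wilsonAction su2Rep (constLift L u) ≤ σ) (hs : ∀ e : Edge 3 L, 0 ≤ scalarPart (W e)) (hw : ∀ (e : Edge 3 L) (c : Fin 3), |vecPart (W e) c| ≤ τ)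
    (hstiff : linkVec L W ∈ stiffSpace L) :
    wilsonAction su2Rep (constLift L u) + (1 - σ / 2) * ‖covCurl (constLift L u) (linkVec L W)‖ ^ 2 - stepActionErr (L := L) τ σ ≤
      wilsonAction su2Rep (W * constLift L u) := by
  have h := wilsonAction_step_ge_valley W (constLift L u) hτ hσ hS hs hw
  rw [inner_covCurl_plaqCurv_constLift_eq_zero u hstiff, mul_zero, add_zero] at h
  exact h

/-- The slow-manifold action is the one-site action: `S(constLift u) = L³·S₁(u)` (tree `wilsonAction_constLift`, restated in this namespace's vocabulary for the chart).
[cite: Luscher1983, §3] -/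
theorem wilsonAction_constLift_eq (u : GaugeConfig 3 1 SU2) :
    wilsonAction su2Rep (constLift L u) = (L : ℝ) ^ 3 * wilsonAction su2Rep u := by
  exact wilsonAction_constLift su2Rep L u

end Summit.QuantumFields.YangMills.Theorems.FemtoTransferGap.TwoLattice.Toron

end
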